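import Mathlib
import Literature.MathematicalPhysics.QuantumLattice.WilsonDiracAP
import Summits.QuantumFields.QCD.Theorems.QuarksAsStableActionUnquenchedChessboardBoundStubChessboard
import Summits.QuantumFields.QCD.Theorems.QuarksAsStableActionUnquenchedChessboardBoundStubAxisSwap
import Summits.QuantumFields.QCD.Theorems.QuarksAsStableActionCriticalLineDiamagnetismStubQuarkChessboardOfSchwarzAux1

/-!
# The antiperiodic Wilson determinant under translations and axis exchanges; hypercube letters
(helper for crux stmt-QuantumFields-9734, line `Sketch`, stub `stub_quarkChessboard_of_schwarz`,
auxiliary file 2; registered sub-goal `stub_quarkChessboard_of_schwarzAux2`)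

(1) FIELDS.  For `dAP V = det D_W[V with the links (x, μ), x_μ = L - 1, negated]` (the all-axes
antiperiodic `r = 1` Wilson determinant of a `U(N)` field, as inlined in items
stmt-QuantumFields-9306/10349): `dAP` is real (`dAP_im`, `γ₅`-hermiticity,
`fermionDet_wilsonDirac_im_holds`), translation invariant (`dAP_translate`: the seam
`x_μ = L - 1 ↔ x_μ = -1` is `apTwistAt (fun _ => -1)`, translations move seams, seams are relocated
by `fermionDet_wilsonDirac_apTwistAt`) and invariant under the exchange `σ = (0 i)` of the time
axis with axis `i` (`dAP_swap`, from `AxisSwap.det_wilsonDirac_swap`).  The positive/negative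
doubles of item 10349 written in a general axis `i` are carried to the axis-`0` doubles of the
exchanged field (`doubleP_swap`, `doubleM_swap`), so the background Schwarz inequality in axis `0`
gives it in every axis (`bs_axis`).
(2) LETTERS.  The finite alphabet `(ℤ/L)⁴ × (ℤ/2)⁴` (cell label `c`, reflection flags `s`) with the
commuting involutions `r i (c, s) = (c, s + eᵢ)` is interpreted into closed-unit-hypercube link
data of `U`: `rd (c, s) ε μ` reads the `μ`-link at corner `ε` of the `s`-reflected hypercube with
lowest corner `c` (`U (c + [ε + s]_{≠ μ}, μ)`, inverted iff `s μ = 1`).  We check the reflection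
rules (`rd_r_same`, `rd_r_of_ne`), that the word `c ↦ (c, 0)` is consistent with field `U`
(`cons_word`, `fld_word`), that the universal pattern word of the letter `(c, 0)` is
`x ↦ (c, parities of x)` (`pattern_eq`), consistent (`cons_pattern`), with field the translate by
`c` of the reflection tiling `tile c U` of item 9306 (`fld_pattern`).  No definitions.
-/

noncomputable section

open scoped BigOperators Classical Matrix ComplexConjugate
open Finset
open Literature.MathematicalPhysics.QuantumLattice Literature.MathematicalPhysics.QuantumFieldTheory

namespace Summit.QuantumFields.QCD.Cruxes.CriticalLineDiamagnetism.ChessboardCellGain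

/-! ### The antiperiodic determinant: reality, translations, axis exchanges, doubles -/

section Fields

variable {N L : ℕ} [NeZero L] (m : ℝ)
  {dAP : GaugeConfig 4 L (Matrix.unitaryGroup (Fin N) ℂ) → ℂ}
  (hdAP : ∀ V, dAP V = (wilsonDirac (unitaryFundamentalRep (Fin N) ℂ)
    (fun e => if (e.1 e.2).val + 1 = L then -V e else V e) m 1).det)

omit [NeZero L] in
/-- Seam convention: on `ZMod L` (`L ≠ 0`), `x.val + 1 = L ↔ x = -1`. -/
theorem val_add_one_eq_iff' [NeZero L] (x : ZMod L) : x.val + 1 = L ↔ x = -1 := by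
  -- adapted from `val_add_one_eq_iff` (Theorems/QuarksAsStableActionWilsonQuarkStabilityStubTransferEven)
  obtain ⟨n, hn⟩ : ∃ n, L = n + 1 := Nat.exists_eq_succ_of_ne_zero (NeZero.ne L)
  subst hn
  constructor
  · intro h
    have h1 : ((x.val + 1 : ℕ) : ZMod (n + 1)) = 0 := by
      rw [h]
      exact ZMod.natCast_self _
    rw [Nat.cast_add, Nat.cast_one, ZMod.natCast_zmod_val] at h1
    exact eq_neg_of_add_eq_zero_left h1
  · rintro rfl
    rw [ZMod.val_neg_one]

/-- The items' seam `(e.1 e.2).val + 1 = L` is the tree's `apTwistAt (fun _ => -1)`. -/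
theorem seam_eq_apTwistAt' (W : GaugeConfig 4 L (Matrix.unitaryGroup (Fin N) ℂ)) :
    (fun e : Edge 4 L => if (e.1 e.2).val + 1 = L then -W e else W e) =
      apTwistAt (fun _ => (-1 : ZMod L)) W := by
  -- adapted from `seam_eq_apTwistAt` (Theorems/QuarksAsStableActionWilsonQuarkStabilityStubTransferEven)
  funext e
  rw [apTwistAt_apply]
  by_cases h : e.1 e.2 = -1
  · rw [if_pos ((val_add_one_eq_iff' _).2 h), if_pos h]
  · rw [if_neg (fun h' => h ((val_add_one_eq_iff' _).1 h')), if_neg h]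

include hdAP in
/-- **`dAP` is real**: `Im det D_W = 0` for unitary links (`γ₅`-hermiticity). -/
theorem dAP_im (V : GaugeConfig 4 L (Matrix.unitaryGroup (Fin N) ℂ)) : (dAP V).im = 0 := by
  rw [hdAP]
  exact fermionDet_wilsonDirac_im_holds (unitaryFundamentalRep (Fin N) ℂ)
    unitaryFundamentalRep_mem_unitaryGroup _ m 1

include hdAP in
/-- **`dAP` is translation invariant** (translate, then relocate the four seams). -/
theorem dAP_translate (V : GaugeConfig 4 L (Matrix.unitaryGroup (Fin N) ℂ)) (v : Site 4 L) :
    dAP (fun e => V (e.1 + v, e.2)) = dAP V := by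
  have hW : (fun e : Edge 4 L => V (e.1 + v, e.2)) = torusConfigShift (-v) V := by
    funext e
    rw [torusConfigShift_apply, sub_neg_eq_add]
  rw [hdAP, hdAP, seam_eq_apTwistAt', seam_eq_apTwistAt', hW]
  have h1 := fermionDet_wilsonDirac_apTwistAt (N := N) (fun _ => (-1 : ZMod L))
    ((fun _ => (-1 : ZMod L)) + v + -v) (torusConfigShift (-v) V) m 1
  have h2 := apTwistAt_torusConfigShift ((fun _ => (-1 : ZMod L)) + v) (-v) V
  have h3 := fermionDet_wilsonDirac_torusConfigShift (unitaryFundamentalRep (Fin N) ℂ) (-v)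
    (apTwistAt ((fun _ => (-1 : ZMod L)) + v) V) m 1
  have h4 := fermionDet_wilsonDirac_apTwistAt (N := N) ((fun _ => (-1 : ZMod L)) + v)
    (fun _ => (-1 : ZMod L)) V m 1
  rw [← h2] at h1
  exact h1.trans (h3.trans h4)

include hdAP in
/-- **`dAP` is invariant under the exchange of the time axis with axis `i`** (the seam set is
exchange invariant; `AxisSwap.det_wilsonDirac_swap`). -/
theorem dAP_swap (V : GaugeConfig 4 L (Matrix.unitaryGroup (Fin N) ℂ)) (i : Fin 4) :
    dAP (fun e => V (e.1 ∘ ⇑(Equiv.swap (0 : Fin 4) i), Equiv.swap (0 : Fin 4) i e.2)) = dAP V := by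
  rw [hdAP, hdAP]
  have h := Theorems.UnquenchedChessboardBoundLine.AxisSwap.det_wilsonDirac_swap
    (unitaryFundamentalRep (Fin N) ℂ) unitaryFundamentalRep_mem_unitaryGroup
    (fun e : Edge 4 L => if (e.1 e.2).val + 1 = L then -V e else V e) i m
  simpa only [Function.comp_apply, Equiv.swap_apply_self] using h

/-- **Registered sub-goal of this auxiliary file**: the all-axes antiperiodic Wilson determinant
of a `U(N)` field (seams `x_μ = L - 1`, as inlined in items stmt-QuantumFields-9306/10349) is
invariant under the exchange of the time axis with the axis `i` acting on sites and directions. -/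
theorem stub_quarkChessboard_of_schwarzAux2 :
    ∀ {N L : ℕ} [NeZero L] (m : ℝ) (V : GaugeConfig 4 L (Matrix.unitaryGroup (Fin N) ℂ)) (i : Fin 4),
      (wilsonDirac (unitaryFundamentalRep (Fin N) ℂ) (fun e => if (e.1 e.2).val + 1 = L
        then -V (e.1 ∘ ⇑(Equiv.swap (0 : Fin 4) i), Equiv.swap (0 : Fin 4) i e.2)
        else V (e.1 ∘ ⇑(Equiv.swap (0 : Fin 4) i), Equiv.swap (0 : Fin 4) i e.2)) m 1).det =
      (wilsonDirac (unitaryFundamentalRep (Fin N) ℂ)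
        (fun e => if (e.1 e.2).val + 1 = L then -V e else V e) m 1).det := by
  intro N L _ m V i
  exact dAP_swap m (dAP := fun W => (wilsonDirac (unitaryFundamentalRep (Fin N) ℂ)
    (fun e => if (e.1 e.2).val + 1 = L then -W e else W e) m 1).det) (fun _ => rfl) V i

omit [NeZero L] in
/-- `(x ∘ σ) i = x 0` for `σ = (0 i)`. -/
theorem comp_swap_apply (x : Site 4 L) (i : Fin 4) : (x ∘ ⇑(Equiv.swap (0 : Fin 4) i)) i = x 0 := by
  rw [Function.comp_apply, Equiv.swap_apply_right]

/-- `σ μ = i ↔ μ = 0` for `σ = (0 i)`. -/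
theorem swap_eq_iff (i μ : Fin 4) : Equiv.swap (0 : Fin 4) i μ = i ↔ μ = 0 := by
  rw [Equiv.swap_apply_eq_iff, Equiv.swap_apply_right]

omit [NeZero L] in
/-- `x[0 ↦ t] ∘ σ = (x ∘ σ)[i ↦ t]`. -/
theorem update_comp_swap (x : Site 4 L) (i : Fin 4) (t : ZMod L) :
    Function.update x 0 t ∘ ⇑(Equiv.swap (0 : Fin 4) i) =
      Function.update (x ∘ ⇑(Equiv.swap (0 : Fin 4) i)) i t := by
  rw [Function.update_comp_equiv, Equiv.symm_swap, Equiv.swap_apply_left]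

/-- `σ ν = 0 ↔ ν = i` for `σ = (0 i)`. -/
theorem swap_eq_zero_iff (i ν : Fin 4) : Equiv.swap (0 : Fin 4) i ν = 0 ↔ ν = i := by
  rw [Equiv.swap_apply_eq_iff, Equiv.swap_apply_left]

omit [NeZero L] in
/-- `(x + e₀) ∘ σ = (x ∘ σ) + eᵢ`. -/
theorem shift_comp_swap (x : Site 4 L) (i : Fin 4) :
    Site.shift x 0 ∘ ⇑(Equiv.swap (0 : Fin 4) i) = Site.shift (x ∘ ⇑(Equiv.swap (0 : Fin 4) i)) i := by
  funext ν
  simp only [Site.shift, Function.comp_apply, Pi.add_apply, Pi.single_apply, swap_eq_zero_iff]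

variable {Dp Dm : Fin 4 → GaugeConfig 4 L (Matrix.unitaryGroup (Fin N) ℂ) →
    GaugeConfig 4 L (Matrix.unitaryGroup (Fin N) ℂ)}
  (hDp : ∀ i V e, Dp i V e =
    if (if e.2 = i then (e.1 i).val < L / 2 else (e.1 i).val ≤ L / 2) then V e
    else if e.2 = i then (V (Function.update (Site.shift e.1 i) i (-Site.shift e.1 i i), i))⁻¹
      else V (Function.update e.1 i (-e.1 i), e.2))
  (hDm : ∀ i V e, Dm i V e =
    if (if e.2 = i then (e.1 i).val < L / 2 else (e.1 i).val ≤ L / 2) then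
      (if e.2 = i then (V (Function.update (Site.shift e.1 i) i (-Site.shift e.1 i i), i))⁻¹
      else V (Function.update e.1 i (-e.1 i), e.2))
    else V e)

omit [NeZero L] in
include hDp in
/-- The positive double in axis `i`, exchanged, is the positive double in axis `0` of the
exchanged field. -/
theorem doubleP_swap (i : Fin 4) (V : GaugeConfig 4 L (Matrix.unitaryGroup (Fin N) ℂ)) :
    Dp 0 (fun e => V (e.1 ∘ ⇑(Equiv.swap (0 : Fin 4) i), Equiv.swap (0 : Fin 4) i e.2)) =
      fun e => Dp i V (e.1 ∘ ⇑(Equiv.swap (0 : Fin 4) i), Equiv.swap (0 : Fin 4) i e.2) := by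
  funext ⟨x, μ⟩
  simp only [hDp, swap_eq_iff, comp_swap_apply, Equiv.swap_apply_left, update_comp_swap,
    shift_comp_swap, shift_apply_same]

omit [NeZero L] in
include hDm in
/-- The negative double in axis `i`, exchanged, is the negative double in axis `0` of the
exchanged field. -/
theorem doubleM_swap (i : Fin 4) (V : GaugeConfig 4 L (Matrix.unitaryGroup (Fin N) ℂ)) :
    Dm 0 (fun e => V (e.1 ∘ ⇑(Equiv.swap (0 : Fin 4) i), Equiv.swap (0 : Fin 4) i e.2)) =
      fun e => Dm i V (e.1 ∘ ⇑(Equiv.swap (0 : Fin 4) i), Equiv.swap (0 : Fin 4) i e.2) := by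
  funext ⟨x, μ⟩
  simp only [hDm, swap_eq_iff, comp_swap_apply, Equiv.swap_apply_left, update_comp_swap,
    shift_comp_swap, shift_apply_same]

include hdAP hDp hDm in
/-- **The background Schwarz inequality in every axis** from the one in the time axis
(item stmt-QuantumFields-10349), by the hypercubic covariance of `dAP`. -/
theorem bs_axis
    (h0 : ∀ V, 0 ≤ (dAP (Dp 0 V)).re ∧ (dAP (Dp 0 V)).im = 0 ∧ 0 ≤ (dAP (Dm 0 V)).re ∧
      (dAP (Dm 0 V)).im = 0 ∧ ‖dAP V‖ ^ 2 ≤ (dAP (Dp 0 V)).re * (dAP (Dm 0 V)).re)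
    (i : Fin 4) (V : GaugeConfig 4 L (Matrix.unitaryGroup (Fin N) ℂ)) :
    0 ≤ (dAP (Dp i V)).re ∧ (dAP (Dp i V)).im = 0 ∧ 0 ≤ (dAP (Dm i V)).re ∧
      (dAP (Dm i V)).im = 0 ∧ ‖dAP V‖ ^ 2 ≤ (dAP (Dp i V)).re * (dAP (Dm i V)).re := by
  have h := h0 (fun e => V (e.1 ∘ ⇑(Equiv.swap (0 : Fin 4) i), Equiv.swap (0 : Fin 4) i e.2))
  rw [doubleP_swap hDp i V, doubleM_swap hDm i V, dAP_swap m hdAP, dAP_swap m hdAP,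
    dAP_swap m hdAP] at h
  exact h

end Fields

/-! ### Hypercube letters: the alphabet `(ℤ/L)⁴ × (ℤ/2)⁴` read into link data of `U` -/

section Letters

variable {N L : ℕ} [NeZero L] (U : GaugeConfig 4 L (Matrix.unitaryGroup (Fin N) ℂ))
  {r : Fin 4 → Site 4 L × (Fin 4 → ZMod 2) → Site 4 L × (Fin 4 → ZMod 2)}
  (hr : ∀ i a, r i a = (a.1, a.2 + Pi.single i 1))
  {rd : Site 4 L × (Fin 4 → ZMod 2) → (Fin 4 → ZMod 2) → Fin 4 → Matrix.unitaryGroup (Fin N) ℂ}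
  (hrd : ∀ a ε μ, rd a ε μ = if a.2 μ = 1 then
      (U (a.1 + fun ν => if ν = μ then 0 else (((ε ν + a.2 ν).val : ℕ) : ZMod L), μ))⁻¹
    else U (a.1 + fun ν => if ν = μ then 0 else (((ε ν + a.2 ν).val : ℕ) : ZMod L), μ))

omit [NeZero L] in
include hr in
/-- The cube reflections of letters are involutions. -/
theorem r_involutive (i : Fin 4) : Function.Involutive (r i) := fun a => by
  rw [hr, hr]
  simp only [add_assoc, single_one_add_single_one, add_zero, Prod.mk.eta]

omit [NeZero L] in
include hr in
/-- The cube reflections of letters commute. -/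
theorem r_comm (i j : Fin 4) (a : Site 4 L × (Fin 4 → ZMod 2)) : r i (r j a) = r j (r i a) := by
  simp only [hr]
  rw [add_right_comm]

omit [NeZero L] in
include hr in
/-- Iterated cube reflections only flip a flag. -/
theorem iterate_r (i : Fin 4) (n : ℕ) (a : Site 4 L × (Fin 4 → ZMod 2)) :
    (r i)^[n] a = (a.1, a.2 + Pi.single i (n : ZMod 2)) := by
  induction n with
  | zero => rw [Function.iterate_zero_apply, Nat.cast_zero, Pi.single_zero, add_zero]
  | succ n ih =>
    rw [Function.iterate_succ_apply', ih, hr]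
    simp only [Nat.cast_succ, Pi.single_add, add_assoc]

omit [NeZero L] in
include hr in
/-- **The universal pattern word of the letter `(c, 0)`** is `x ↦ (c, parities of x)`. -/
theorem pattern_eq (c x : Site 4 L) :
    (r 0)^[(x 0).val] ((r 1)^[(x 1).val] ((r 2)^[(x 2).val] ((r 3)^[(x 3).val]
      ((c, 0) : Site 4 L × (Fin 4 → ZMod 2))))) = (c, fun ν => (((x ν).val : ℕ) : ZMod 2)) := by
  simp only [iterate_r hr, zero_add]
  refine Prod.ext rfl (funext fun ν => ?_)
  fin_cases ν <;> simp

omit [NeZero L] in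
include hrd in
/-- Two link readings agree when they read the same link with the same orientation. -/
theorem rd_congr {a b : Site 4 L × (Fin 4 → ZMod 2)} {ε ε' : Fin 4 → ZMod 2} {μ : Fin 4}
    (hflag : a.2 μ = b.2 μ) (hbase : a.1 μ = b.1 μ)
    (hoff : ∀ ν, ν ≠ μ → a.1 ν + (((ε ν + a.2 ν).val : ℕ) : ZMod L) =
      b.1 ν + (((ε' ν + b.2 ν).val : ℕ) : ZMod L)) :
    rd a ε μ = rd b ε' μ := by
  have hs : (a.1 + fun ν => if ν = μ then 0 else (((ε ν + a.2 ν).val : ℕ) : ZMod L)) =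
      b.1 + fun ν => if ν = μ then 0 else (((ε' ν + b.2 ν).val : ℕ) : ZMod L) := by
    funext ν
    simp only [Pi.add_apply]
    by_cases hν : ν = μ
    · subst hν
      rw [if_pos rfl, if_pos rfl, add_zero, add_zero, hbase]
    · rw [if_neg hν, if_neg hν]
      exact hoff ν hν
  rw [hrd, hrd, hflag, hs]

omit [NeZero L] in
include hr hrd in
/-- Reflecting a hypercube in axis `i` reverses and inverts its `i`-links. -/
theorem rd_r_same (i : Fin 4) (a : Site 4 L × (Fin 4 → ZMod 2)) (ε : Fin 4 → ZMod 2) :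
    rd (r i a) ε i = (rd a ε i)⁻¹ := by
  have hs : ((r i a).1 + fun ν => if ν = i then 0 else (((ε ν + (r i a).2 ν).val : ℕ) : ZMod L)) =
      a.1 + fun ν => if ν = i then 0 else (((ε ν + a.2 ν).val : ℕ) : ZMod L) := by
    funext ν
    simp only [hr, Pi.add_apply]
    by_cases hν : ν = i
    · subst hν
      rw [if_pos rfl, if_pos rfl]
    · rw [if_neg hν, if_neg hν, Pi.single_eq_of_ne hν, add_zero]
  rw [hrd, hrd, hs]
  simp only [hr, Pi.add_apply, Pi.single_eq_same]
  rcases (by decide : ∀ t : ZMod 2, t = 0 ∨ t = 1) (a.2 i) with h | h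
  · rw [h, if_pos (by decide), if_neg (by decide)]
  · rw [h, if_neg (by decide), if_pos (by decide), inv_inv]

omit [NeZero L] in
include hr hrd in
/-- Reflecting a hypercube in axis `i` reads its transverse links at the corner flipped in `i`. -/
theorem rd_r_of_ne (i : Fin 4) (a : Site 4 L × (Fin 4 → ZMod 2)) (ε : Fin 4 → ZMod 2) {μ : Fin 4}
    (hμ : μ ≠ i) : rd (r i a) ε μ = rd a (ε + Pi.single i 1) μ := by
  refine rd_congr U hrd ?_ ?_ fun ν _ => ?_
  · simp only [hr, Pi.add_apply, Pi.single_eq_of_ne hμ, add_zero]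
  · simp only [hr]
  · simp only [hr, Pi.add_apply]
    rw [show ε ν + (a.2 ν + (Pi.single i 1 : Fin 4 → ZMod 2) ν) =
      ε ν + (Pi.single i 1 : Fin 4 → ZMod 2) ν + a.2 ν by ring]

omit [NeZero L] in
include hrd in
/-- **The word `c ↦ (c, 0)` of `U` is consistent.** -/
theorem cons_word (z : Site 4 L) (j μ : Fin 4) (ε : Fin 4 → ZMod 2) (hμ : μ ≠ j) (hε : ε j = 0) :
    rd (z, 0) (ε + Pi.single j 1) μ = rd (Site.shift z j, 0) ε μ := by
  refine rd_congr U hrd rfl (shift_apply_of_ne z hμ).symm fun ν _ => ?_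
  simp only [Pi.add_apply, Pi.zero_apply, add_zero]
  rcases eq_or_ne ν j with rfl | hνj
  · rw [hε, Pi.single_eq_same, shift_apply_same, zero_add, ZMod.val_zero, Nat.cast_zero, add_zero,
      show (1 : ZMod 2).val = 1 from rfl, Nat.cast_one]
  · rw [Pi.single_eq_of_ne hνj, add_zero, shift_apply_of_ne z hνj]

omit [NeZero L] in
include hrd in
/-- **The field of the word `c ↦ (c, 0)` is `U`.** -/
theorem fld_word (x : Site 4 L) (μ : Fin 4) : rd (x, 0) 0 μ = U (x, μ) := by
  rw [hrd, if_neg (show ¬((0 : Fin 4 → ZMod 2) μ = 1) by simp)]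
  congr 2
  funext ν
  simp only [Pi.add_apply, Pi.zero_apply, add_zero, ZMod.val_zero, Nat.cast_zero, ite_self]

/-- For even `L`, parities of representatives are additive. -/
theorem natCast_val_add (hL : Even L) (u v : ZMod L) :
    (((u + v).val : ℕ) : ZMod 2) = ((u.val : ℕ) : ZMod 2) + ((v.val : ℕ) : ZMod 2) := by
  simp only [Theorems.UnquenchedChessboardBoundLine.Chessboard.natCast_val_eq_castHom hL, map_add]

/-- For even `L`, the representative of `1` is odd. -/
theorem natCast_val_one (hL : Even L) : (((1 : ZMod L).val : ℕ) : ZMod 2) = 1 := by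
  rw [ZMod.val_one_eq_one_mod, Nat.mod_eq_of_lt (two_le_of_even' hL), Nat.cast_one]

/-- For even `L`, the parity of the representative of `u + 1` is the opposite one. -/
theorem val_add_one_mod_two (hL : Even L) (u : ZMod L) : (u + 1).val % 2 = (u.val + 1) % 2 := by
  rw [ZMod.val_add, ZMod.val_one_eq_one_mod, Nat.mod_eq_of_lt (two_le_of_even' hL),
    Nat.mod_mod_of_dvd _ hL.two_dvd]

include hrd in
/-- **The universal pattern word `x ↦ (c, parities of x)` is consistent** (`L` even). -/
theorem cons_pattern (hL : Even L) (c z : Site 4 L) (j μ : Fin 4) (ε : Fin 4 → ZMod 2)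
    (hμ : μ ≠ j) (hε : ε j = 0) :
    rd (c, fun ν => (((z ν).val : ℕ) : ZMod 2)) (ε + Pi.single j 1) μ =
      rd (c, fun ν => (((Site.shift z j ν).val : ℕ) : ZMod 2)) ε μ := by
  refine rd_congr U hrd ?_ rfl fun ν _ => ?_
  · show (((z μ).val : ℕ) : ZMod 2) = (((Site.shift z j μ).val : ℕ) : ZMod 2)
    rw [shift_apply_of_ne z hμ]
  · show c ν + (((ε ν + (Pi.single j 1 : Fin 4 → ZMod 2) ν + (((z ν).val : ℕ) : ZMod 2)).val : ℕ) :
        ZMod L) =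
      c ν + (((ε ν + (((Site.shift z j ν).val : ℕ) : ZMod 2)).val : ℕ) : ZMod L)
    rcases eq_or_ne ν j with rfl | hνj
    · rw [Pi.single_eq_same, shift_apply_same, natCast_val_add hL, natCast_val_one hL, hε, zero_add,
        zero_add, add_comm (1 : ZMod 2)]
    · rw [Pi.single_eq_of_ne hνj, shift_apply_of_ne z hνj, add_zero]

include hrd in
/-- **The field of the universal pattern word of `(c, 0)` is the translate by `c` of the
reflection tiling `tile c U`** of item stmt-QuantumFields-9306 (`L` even). -/
theorem fld_pattern (hL : Even L)
    {tile : Site 4 L → GaugeConfig 4 L (Matrix.unitaryGroup (Fin N) ℂ) →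
      GaugeConfig 4 L (Matrix.unitaryGroup (Fin N) ℂ)}
    (htile : ∀ c V e, tile c V e = if (e.1 e.2 - c e.2).val % 2 = 0
      then V (fun ν => c ν + (((e.1 ν - c ν).val % 2 : ℕ) : ZMod L), e.2)
      else (V (fun ν => c ν + (((Site.shift e.1 e.2 ν - c ν).val % 2 : ℕ) : ZMod L), e.2))⁻¹)
    (c x : Site 4 L) (μ : Fin 4) :
    rd (c, fun ν => (((x ν).val : ℕ) : ZMod 2)) 0 μ = tile c U (x + c, μ) := by
  have hs : ∀ ν, Site.shift (x + c) μ ν - c ν = Site.shift x μ ν := fun ν => by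
    simp only [Site.shift, Pi.add_apply]; ring
  rw [htile, hrd]
  simp only [Pi.add_apply, add_sub_cancel_right, Pi.zero_apply, zero_add, ZMod.val_natCast, hs]
  have h1 : ((((x μ).val : ℕ) : ZMod 2) = 1) ↔ (x μ).val % 2 = 1 := by
    rw [← Nat.cast_one, ZMod.natCast_eq_natCast_iff', Nat.one_mod]
  rcases Nat.mod_two_eq_zero_or_one (x μ).val with h | h
  · rw [if_neg (fun h' => by rw [h1] at h'; omega), if_pos h]
    congr 2
    funext ν
    simp only [Pi.add_apply]
    by_cases hν : ν = μ
    · subst hν; rw [if_pos rfl, h, Nat.cast_zero]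
    · rw [if_neg hν]
  · rw [if_pos (h1.2 h), if_neg (by omega)]
    congr 3
    funext ν
    simp only [Pi.add_apply]
    by_cases hν : ν = μ
    · subst hν
      rw [if_pos rfl, shift_apply_same, val_add_one_mod_two hL,
        show ((x ν).val + 1) % 2 = 0 by omega, Nat.cast_zero]
    · rw [if_neg hν, shift_apply_of_ne x hν]

end Letters

end Summit.QuantumFields.QCD.Cruxes.CriticalLineDiamagnetism.ChessboardCellGain

end
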